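import Summits.BirchSwinnertonDyer.BirchSwinnertonDyer.Theorems.AdditiveKolyvaginRoadManinFrameResidueProperRTameTwistFull
import Summits.BirchSwinnertonDyer.BirchSwinnertonDyer.Theses.TwistFamilyManinDescent
import HarnessLib

/-!
# Sketch — dominant-sign Kato road on the Eisenstein additive Manin residual (crux-ideate seat 2, g17)

`K1⁻` / `K1⁺`: the Kato–Kim–Nakamura Néron-integrality of twisted symbol sums WITHOUT the
irreducibility binder, for the sign whose Manin–Drinfeld (cuspidal) `p`-group vanishes on the other
side; `minusRoad` = the first lemma (port of `not_dvd_c_of_tameTwistL` with `hirr` replaced by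
`PlusCuspidalTrivialAt`). Nothing here is proved; BSD is not proved; Manin `c = 1` is not proved.
-/

open scoped Classical MatrixGroups
open WeierstrassCurve NumberField Literature.NumberTheory.EllipticCurves
  Literature.NumberTheory.EllipticCurves.ModularForms
  Literature.NumberTheory.EllipticCurves.Rank1Residual
  Literature.NumberTheory.DiophantineGeometry IsDedekindDomain Rat.HeightOneSpectrum
  Summit.BirchSwinnertonDyer.Rank1Residual Summit.BirchSwinnertonDyer.Rank1Residual.Additive
  CongruenceSubgroup Complex

namespace Summit.BirchSwinnertonDyer.BirchSwinnertonDyer.Cruxes.EisensteinAdditiveManinResidual.DominantSignKato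

/-- `MD⁺(f)_p = 0`: the real part of every cusp symbol `{∞, r}_f` is `p`-integral against `re Λ_f`
(the `+`-part of the cuspidal subgroup of `ℂ/Λ_f` has no `p`-torsion). -/
def PlusCuspidalTrivialAt {N : ℕ} (f : CuspForm (Gamma0 N) 2) (p : ℕ) : Prop :=
  ∀ r : ℚ, ∃ s : ℕ, ¬ p ∣ s ∧ (s : ℝ) * (modularSymbol f r).re ∈ realPeriods f

/-- `MD⁻(f)_p = 0`: the imaginary part of every cusp symbol is `p`-integral against `im Λ_f`. -/
def MinusCuspidalTrivialAt {N : ℕ} (f : CuspForm (Gamma0 N) 2) (p : ℕ) : Prop :=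
  ∀ r : ℚ, ∃ s : ℕ, ¬ p ∣ s ∧ (s : ℝ) * (modularSymbol f r).im ∈ imagPeriods f

/-- `p ^ n` kills the PLUS cuspidal defect `MD⁺ = Re 𝓛_f ⊗ ℤ_(p) / Re L_f ⊗ ℤ_(p)`:
every `Re {∞, r}_f` lands in `Re Λ_f` after multiplication by `p ^ n` and a prime-to-`p` integer. -/
def PlusCuspidalKilledBy {N : ℕ} (f : CuspForm (Gamma0 N) 2) (p n : ℕ) : Prop :=
  ∀ r : ℚ, ∃ s : ℕ, ¬ p ∣ s ∧ ((s * p ^ n : ℕ) : ℝ) * (modularSymbol f r).re ∈ realPeriods f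

/-- `p ^ n` kills the MINUS cuspidal defect `MD⁻`. -/
def MinusCuspidalKilledBy {N : ℕ} (f : CuspForm (Gamma0 N) 2) (p n : ℕ) : Prop :=
  ∀ r : ℚ, ∃ s : ℕ, ¬ p ∣ s ∧ ((s * p ^ n : ℕ) : ℝ) * (modularSymbol f r).im ∈ imagPeriods f

/-- The MINUS sign is DOMINANT at `p` (`a⁻ ≥ a⁺`): whatever power of `p` kills `MD⁻` kills `MD⁺`.
On such rows Kato's zeta elements restricted to `p^{a⁻} · V_{ℤ_p}(f)(1) ⊆ T_pE₀` exhaust `(T_pE₀)⁻`. -/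
def MinusDominantAt {N : ℕ} (f : CuspForm (Gamma0 N) 2) (p : ℕ) : Prop :=
  ∀ n : ℕ, MinusCuspidalKilledBy f p n → PlusCuspidalKilledBy f p n

/-- The PLUS sign is DOMINANT at `p` (`a⁺ ≥ a⁻`). -/
def PlusDominantAt {N : ℕ} (f : CuspForm (Gamma0 N) 2) (p : ℕ) : Prop :=
  ∀ n : ℕ, PlusCuspidalKilledBy f p n → MinusCuspidalKilledBy f p n

/-- (S) TOTALITY of the dichotomy — from Manin–Drinfeld (`𝓛_f/L_f` finite): one sign is dominant.
This is what makes the two half-roads cover EVERY row of the crux with no selector lemma. -/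
def DominanceTotal : Prop :=
  ∀ {N : ℕ} [NeZero N] (f : CuspForm (Gamma0 N) 2) (p : ℕ), p.Prime →
    MinusDominantAt f p ∨ PlusDominantAt f p

/-- `a⁺ = 0` (the census value on every `−`-road row) implies MINUS-dominance. -/
theorem minusDominantAt_of_plusCuspidalTrivialAt {N : ℕ} (f : CuspForm (Gamma0 N) 2) (p : ℕ)
    (h : PlusCuspidalTrivialAt f p) : MinusDominantAt f p := by
  intro n _ r
  obtain ⟨s, hs, hmem⟩ := h r
  refine ⟨s, hs, ?_⟩
  have : ((s * p ^ n : ℕ) : ℝ) * (modularSymbol f r).re = (p ^ n : ℕ) • ((s : ℝ) * (modularSymbol f r).re) := by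
    push_cast; rw [nsmul_eq_mul]; push_cast; ring
  rw [this]
  exact AddSubgroup.nsmul_mem _ hmem _

/-- Mirror of `minusDominantAt_of_plusCuspidalTrivialAt`. -/
theorem plusDominantAt_of_minusCuspidalTrivialAt {N : ℕ} (f : CuspForm (Gamma0 N) 2) (p : ℕ)
    (h : MinusCuspidalTrivialAt f p) : PlusDominantAt f p := by
  intro n _ r
  obtain ⟨s, hs, hmem⟩ := h r
  refine ⟨s, hs, ?_⟩
  have : ((s * p ^ n : ℕ) : ℝ) * (modularSymbol f r).im = (p ^ n : ℕ) • ((s : ℝ) * (modularSymbol f r).im) := by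
    push_cast; rw [nsmul_eq_mul]; push_cast; ring
  rw [this]
  exact AddSubgroup.nsmul_mem _ hmem _

/-- **K0 (census law, 114/114 rows; informational, not load-bearing):** the cuspidal `p`-defect is
ONE-SIGNED, `a⁺ · a⁻ = 0`. Heuristic reason: `MD ⊗ 𝔽_p` is a cyclic Hecke module at the Eisenstein
`𝔪` on which `G_ℚ` acts through one character `ψ ∈ {φ, φ⁻¹χ_p}` of `E[p]^{ss}`, and the two characters
have opposite parity (`χ_p(−1) = −1`), so complex conjugation acts on it by the single sign `ψ(−1)`. -/
def CuspidalDefectOneSigned {N : ℕ} (f : CuspForm (Gamma0 N) 2) (p : ℕ) : Prop :=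
  PlusCuspidalTrivialAt f p ∨ MinusCuspidalTrivialAt f p

/-- One-signedness decides the dominance dichotomy pointwise (so on K0 rows no appeal to
`DominanceTotal` is needed). -/
theorem dominant_of_oneSigned {N : ℕ} (f : CuspForm (Gamma0 N) 2) (p : ℕ)
    (h : CuspidalDefectOneSigned f p) : MinusDominantAt f p ∨ PlusDominantAt f p :=
  h.elim (fun hp => Or.inl (minusDominantAt_of_plusCuspidalTrivialAt f p hp))
    (fun hm => Or.inr (plusDominantAt_of_minusCuspidalTrivialAt f p hm))

/-- **K1⁻ (cite-only candidate, to be audited): dominant-sign Kato–Néron integrality, odd characters,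
NO irreducibility.** For a LATTICE-OPTIMAL datum (`Λ_V = c Λ_f`, i.e. `V` is the `X₀(N)`-optimal curve),
additive `p ≥ 5`, and `MD⁺(f)_p = 0`: Kato's zeta elements restricted to the largest sublattice of
`T_p V` homothetic to Kato's lattice `V_{ℤ_p}(f)(1) = (all symbols) ⊗ ℤ_p` lose nothing on the `−` side,
so Kim–Nakamura's receptacle gives the odd-character half of
`kato_neron_isIntegral_twistedSymbolSum_of_additive_five_le` verbatim.
[cite: Kato2004Asterisque, (8.1.3), Thm. 9.7, Thm. 12.5] [cite: KimNakamura2020, Cor. 2.4]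
[cite: Wuthrich2014, §3 Prop. 8] [cite: KostersPannekoek2017, Thm. 1] -/
def kato_neron_isIntegral_twistedSymbolSum_odd_of_plusCuspidalTrivial : Prop :=
  ∀ (V : WeierstrassCurve ℚ) [V.IsElliptic] [V.IsGloballyMinimal] {N : ℕ} [NeZero N]
    (D : ModularParametrizationData V N)
    (_ : ∀ z ∈ D.L.lattice, ∃ w ∈ periodLattice D.f, z = D.c * w)
    (p : ℕ) [Fact p.Prime] (_ : 5 ≤ p)
    (_ : ¬ V.HasGoodReductionAtPrime p) (_ : ¬ V.HasMultiplicativeReductionAtPrime p)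
    (_ : PlusCuspidalTrivialAt D.f p) (m : ℕ) [NeZero m] (_ : m.Coprime (p * N))
    (_ : 7 < p ∨ (Nat.Coprime (orderOf (p : ZMod m)) (p - 1) ∧
      ∀ P : (V.baseChange ℚ_[p]).toAffine.Point, p • P = 0 → P = 0))
    (χ : DirichletCharacter ℂ m) (_ : χ.IsPrimitive) (_ : χ ≠ 1) (_ : ¬ p ∣ orderOf χ)
    (ϖ : ℚ) (r : ℂ),
    χ.Odd → (ϖ : ℝ) * V.imaginaryPeriodRat = minusPeriod D.f →
      (∏ ℓ ∈ N.primeFactors with ¬ ℓ ^ 2 ∣ N,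
          (((ℓ : ℂ) - (V.LFunction ℓ : ℂ) * χ (ℓ : ZMod m)) *
            ((ℓ : ℂ) - (V.LFunction ℓ : ℂ) * (χ (ℓ : ZMod m))⁻¹))) *
          twistedSymbolSum D.f χ = r * (minusPeriod D.f : ℂ) * Complex.I →
      ∃ s : ℕ, ¬ p ∣ s ∧ IsIntegral ℤ ((s : ℂ) * ϖ * r)

/-- **K1⁺**: the even-character mirror under `MD⁻(f)_p = 0`. -/
def kato_neron_isIntegral_twistedSymbolSum_even_of_minusCuspidalTrivial : Prop :=
  ∀ (V : WeierstrassCurve ℚ) [V.IsElliptic] [V.IsGloballyMinimal] {N : ℕ} [NeZero N]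
    (D : ModularParametrizationData V N)
    (_ : ∀ z ∈ D.L.lattice, ∃ w ∈ periodLattice D.f, z = D.c * w)
    (p : ℕ) [Fact p.Prime] (_ : 5 ≤ p)
    (_ : ¬ V.HasGoodReductionAtPrime p) (_ : ¬ V.HasMultiplicativeReductionAtPrime p)
    (_ : MinusCuspidalTrivialAt D.f p) (m : ℕ) [NeZero m] (_ : m.Coprime (p * N))
    (_ : 7 < p ∨ (Nat.Coprime (orderOf (p : ZMod m)) (p - 1) ∧
      ∀ P : (V.baseChange ℚ_[p]).toAffine.Point, p • P = 0 → P = 0))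
    (χ : DirichletCharacter ℂ m) (_ : χ.IsPrimitive) (_ : χ ≠ 1) (_ : ¬ p ∣ orderOf χ)
    (ϖ : ℚ) (r : ℂ),
    χ.Even → (ϖ : ℝ) * V.realPeriodRat = plusPeriod D.f →
      (∏ ℓ ∈ N.primeFactors with ¬ ℓ ^ 2 ∣ N,
          (((ℓ : ℂ) - (V.LFunction ℓ : ℂ) * χ (ℓ : ZMod m)) *
            ((ℓ : ℂ) - (V.LFunction ℓ : ℂ) * (χ (ℓ : ZMod m))⁻¹))) *
          twistedSymbolSum D.f χ = r * (plusPeriod D.f : ℂ) →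
      ∃ s : ℕ, ¬ p ∣ s ∧ IsIntegral ℤ ((s : ℂ) * ϖ * r)

/-- **First lemma (the `−` road): Manin's `p`-part at a lattice-optimal additive datum with
`MD⁺(f)_p = 0`, NO irreducibility** — the statement of `not_dvd_c_of_tameTwistL` with `hirr`
replaced by `PlusCuspidalTrivialAt D.f p` (and, for `p ∈ {5, 7}`, the Kosters–Pannekoek side
condition on `W(ℚ_p)[p]`), GRANTED `K1⁻`. -/
def MinusRoad : Prop :=
  ∀ (W : WeierstrassCurve ℚ) [W.IsElliptic] [W.IsGloballyMinimal] {N : ℕ} [NeZero N]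
    (D : ModularParametrizationData W N) (p : ℕ) [Fact p.Prime],
    (∀ z ∈ D.L.lattice, ∃ w ∈ periodLattice D.f, z = D.c * w) → 5 ≤ p →
    (7 < p ∨ ∀ P : (W.baseChange ℚ_[p]).toAffine.Point, p • P = 0 → P = 0) →
    Addv W p → p ^ 2 ∣ N →
    (∀ ℓ ∈ N.primeFactors, ¬ ℓ ^ 2 ∣ N → W.LFunction ℓ = 1 ∨ W.LFunction ℓ = -1) →
    PlusCuspidalTrivialAt D.f p → ¬ (p : ℤ) ∣ D.c

/-- The `−` road in its natural generality: MINUS-DOMINANT rows (not only `a⁺ = 0`). -/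
def MinusRoadDominant : Prop :=
  ∀ (W : WeierstrassCurve ℚ) [W.IsElliptic] [W.IsGloballyMinimal] {N : ℕ} [NeZero N]
    (D : ModularParametrizationData W N) (p : ℕ) [Fact p.Prime],
    (∀ z ∈ D.L.lattice, ∃ w ∈ periodLattice D.f, z = D.c * w) → 5 ≤ p →
    (7 < p ∨ ∀ P : (W.baseChange ℚ_[p]).toAffine.Point, p • P = 0 → P = 0) →
    Addv W p → p ^ 2 ∣ N →
    (∀ ℓ ∈ N.primeFactors, ¬ ℓ ^ 2 ∣ N → W.LFunction ℓ = 1 ∨ W.LFunction ℓ = -1) →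
    MinusDominantAt D.f p → ¬ (p : ℤ) ∣ D.c

theorem minusRoad_of_dominant (h : MinusRoadDominant) : MinusRoad := by
  intro W _ _ N _ D p _ hopt hp5 hKP hadd hpN hal hplus
  exact h W D p hopt hp5 hKP hadd hpN hal (minusDominantAt_of_plusCuspidalTrivialAt D.f p hplus)


/-- The port (sorried here; in the tree: clone `pint_im_cuspSymbolL` / `pint_twistedSymbolSum_divL`
with the new binder — `hirr` is consumed only where `hK` is applied). -/
theorem minusRoad_of_K1
    (hK : kato_neron_isIntegral_twistedSymbolSum_odd_of_plusCuspidalTrivial) : MinusRoad := by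
  sorry

/-- **Composition toward the crux on the `−`-habitat**: every instance of
`EisensteinAdditiveManinResidual` whose newform has `MD⁺_p = 0` (and, at `p ∈ {5,7}`, no
`ℚ_p`-rational `p`-torsion on `W`) follows from `MinusRoad` plus `a_ℓ = ±1` at `ℓ ∥ N`. -/
theorem crux_on_minusHabitat (hR : MinusRoad)
    (hal : ∀ (W : WeierstrassCurve ℚ) [W.IsElliptic] [W.IsGloballyMinimal] {N : ℕ} [NeZero N]
      (D : ModularParametrizationData W N), ∀ ℓ ∈ N.primeFactors, ¬ ℓ ^ 2 ∣ N →
        W.LFunction ℓ = 1 ∨ W.LFunction ℓ = -1)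
    (W : WeierstrassCurve ℚ) [W.IsElliptic] [W.IsGloballyMinimal] {N : ℕ} [NeZero N]
    (D : ModularParametrizationData W N) (p : ℕ) (hp : p.Prime)
    (hp' : p = 5 ∨ p = 7 ∨ p = 13 ∨ (p = 163 ∧ 2 ^ 6 ∣ N)) (hpN : p ^ 2 ∣ N)
    (hadd : haveI : Fact p.Prime := ⟨hp⟩; Addv W p)
    (hKP : haveI : Fact p.Prime := ⟨hp⟩;
      7 < p ∨ ∀ P : (W.baseChange ℚ_[p]).toAffine.Point, p • P = 0 → P = 0)
    (hopt : ∀ z ∈ D.L.lattice, ∃ w ∈ periodLattice D.f, z = D.c * w)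
    (hplus : PlusCuspidalTrivialAt D.f p) :
    ¬ (p : ℤ) ∣ D.maninConstant := by
  haveI : Fact p.Prime := ⟨hp⟩
  have hp5 : 5 ≤ p := by
    rcases hp' with rfl | rfl | rfl | ⟨rfl, _⟩ <;> norm_num
  exact hR W D p hopt hp5 hKP hadd hpN (hal W D) hplus

end Summit.BirchSwinnertonDyer.BirchSwinnertonDyer.Cruxes.EisensteinAdditiveManinResidual.DominantSignKato
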